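import Mathlib
import Summits.Ventures.PercRepro2.Defs
import Summits.Ventures.PercRepro2.Graph
import Summits.Ventures.PercRepro2.OneColourSwitch
import Summits.Ventures.PercRepro2.RegionHubSign
import Summits.Ventures.PercRepro2.SideSwitch
import Summits.Ventures.PercRepro2.SideSwitchFibre
import Summits.Ventures.PercRepro2.SideSwitchMono
import Summits.Ventures.PercRepro2.SideSwitchM9
import Summits.Ventures.PercRepro2.SideSwitchClosed
import Summits.Ventures.PercRepro2.SideSwitchComps
import Summits.Ventures.PercRepro2.TermSwitchDefs
import Summits.Ventures.PercRepro2.TermSwitchFibre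
import Summits.Ventures.PercRepro2.TermSwitchCompsFibre
import Summits.Ventures.PercRepro2.TermSwitchMono

/-!
# The side-switch theorem with a terminal set: `Σ_{Sep_H ∩ DZero_H} σ_pq σ_rs ≤ 0` on EVERY graph
(blind cell PercRepro2, p3 g21, 2026-08-27; `proofs/P3-CPNC.md` §18)

For a finite marked multigraph, a terminal set `H ∋ r` (any `s`, any `p, q`), the sum of
`σ_pq · σ_rs` over the colourings in which `p, q` lie in neither two-colour world of `H`
(`sepH`) and no vertex outside `H` lies in both worlds (`DZeroH`) is non-positive
(`dzeroSignSumH_nonpos`).  `H = {r, s}` is `SideSwitch.dzeroSignSum_nonpos`; `H = {r, s, d}` is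
the «`S₃`» piece of the single-`d` route (`dzeroSignSumH_nonpos_triple`); `H = {r, s} ∪ D₀` gives
the piece for every `D₀` (`dzeroSignSumH_nonpos_union`).  Proof: the fibration of
`TermSwitchCompsFibre`, the per-representative identity
`σ_pq(ρ_T) + σ_pq(ρ^O_T) = G(T) − G(compsH ∖ T)` with `G` increasing and `σ_rs(ρ_T)` decreasing
(`TermSwitchMono`), Harris on the uniform hypercube (`harris_powerset`) with
`Σ_T (G(T) − G(compsH ∖ T)) = 0`.  Own work; std axioms.
-/

namespace Summit.Ventures.PercRepro2

namespace TermSwitch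

open Finset Classical RegionHub OneColourSwitch SideSwitch

variable {V : Type*} {E : Type*}

section Count

variable [Fintype V] [DecidableEq V] [Fintype E] [DecidableEq E]

variable {ends : E → Sym2 V}

omit [Fintype E] [DecidableEq E] in
/-- The outside is preserved by a component assignment. -/
lemma OsetH_assignC {H : Set V} {ρ : Config E} {T : Finset (Finset V)}
    (hT : T ⊆ compsH ends H ρ) : OsetH ends H (assignC ends T ρ) = OsetH ends H ρ := by
  obtain ⟨_, h2, h3⟩ := switch_data_unionT_H hT
  simp only [OsetH, assignC, assign]
  rw [UH_flipTouch_of_closed h2 h3]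

omit [Fintype E] [DecidableEq E] in
/-- `σ_rs` of the component assignment of the outside-flipped representative, for a terminal
`r`. -/
lemma sigma_rs_assignC_flipOH {H : Set V} {ρ : Config E} {r : V} (hr : r ∈ H) (s : V)
    {T : Finset (Finset V)} (hT : T ⊆ compsH ends H ρ) :
    sigma ends (assignC ends T (flipOH ends H ρ)) r s = sigma ends (assignC ends T ρ) r s := by
  have h : assignC ends T (flipOH ends H ρ) =
      flipIn ends (OsetH ends H (assignC ends T ρ)) (assignC ends T ρ) := by
    rw [OsetH_assignC hT]
    simp only [flipOH, assignC, assign]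
    exact (flipIn_flipTouch _ _ _).symm
  rw [h, sigma_flipIn_OsetH hr]

/-- **The per-representative identity** for component assignments:
`σ_pq(ρ_T) + σ_pq(ρ^O_T) = G(T) − G(compsH ∖ T)`. -/
lemma sigma_pq_add_flipOH_C {p q : V} {H : Set V} {ρ : Config E} (hρ : ρ ∈ RepH ends p q H)
    {T : Finset (Finset V)} (hT : T ⊆ compsH ends H ρ) :
    sigma ends (assignC ends T ρ) p q + sigma ends (assignC ends T (flipOH ends H ρ)) p q =
      ((if Conn ends (assignC ends T ρ) p q then (1 : ℤ) else 0) +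
        (if Conn ends (assignC ends T (flipOH ends H ρ)) p q then 1 else 0)) -
      ((if Conn ends (assignC ends (compsH ends H ρ \ T) ρ) p q then (1 : ℤ) else 0) +
        (if Conn ends (assignC ends (compsH ends H ρ \ T) (flipOH ends H ρ)) p q then 1
          else 0)) := by
  have hρO := flipOH_mem_RepH hρ
  have hTO : T ⊆ compsH ends H (flipOH ends H ρ) := by rw [compsH_flipOH]; exact hT
  have e1 := conn_pq_compl_assignC_H hρ hT
  have e2 := conn_pq_compl_assignC_H hρO hTO
  rw [compsH_flipOH, flipOH_flipOH] at e2
  unfold sigma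
  simp only [e1, e2]
  ring

/-- The terminal-set sign sum: `Σ_{ω ∈ Sep_H ∩ DZero_H} σ_pq · σ_rs`. -/
noncomputable def dzeroSignSumH (ends : E → Sym2 V) (p q r s : V) (H : Set V) : ℤ :=
  ∑ ω : Config E, if sepH ends p q H ω ∧ DZeroH ends H ω then
    sigma ends ω p q * sigma ends ω r s else 0

/-- **The side-switch theorem with a terminal set**: for every finite marked multigraph and
every terminal set `H ∋ r`, `Σ_{ω ∈ Sep_H ∩ DZero_H} σ_pq · σ_rs ≤ 0`. -/
theorem dzeroSignSumH_nonpos (p q : V) {r : V} (s : V) {H : Set V} (hr : r ∈ H) :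
    dzeroSignSumH ends p q r s H ≤ 0 := by
  have hsum : dzeroSignSumH ends p q r s H =
      ∑ ρ ∈ RepH ends p q H, ∑ T ∈ (compsH ends H ρ).powerset,
        sigma ends (assignC ends T ρ) p q * sigma ends (assignC ends T ρ) r s := by
    rw [dzeroSignSumH, ← Finset.sum_filter]
    rw [← sum_dzeroH_eq_sum_repH_comps (fun ω => sigma ends ω p q * sigma ends ω r s)]
    refine Finset.sum_congr ?_ (fun _ _ => rfl)
    ext ω
    simp [DZeroSetH, SepSetH]
  have hsumO : (∑ ρ ∈ RepH ends p q H, ∑ T ∈ (compsH ends H ρ).powerset,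
        sigma ends (assignC ends T ρ) p q * sigma ends (assignC ends T ρ) r s) =
      ∑ ρ ∈ RepH ends p q H, ∑ T ∈ (compsH ends H ρ).powerset,
        sigma ends (assignC ends T (flipOH ends H ρ)) p q *
          sigma ends (assignC ends T ρ) r s := by
    symm
    refine Finset.sum_nbij' (fun ρ => flipOH ends H ρ) (fun ρ => flipOH ends H ρ)
      (fun ρ hρ => flipOH_mem_RepH hρ) (fun ρ hρ => flipOH_mem_RepH hρ)
      (fun ρ _ => flipOH_flipOH H ρ) (fun ρ _ => flipOH_flipOH H ρ) ?_
    intro ρ _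
    rw [compsH_flipOH]
    refine Finset.sum_congr rfl (fun T hT => ?_)
    rw [sigma_rs_assignC_flipOH hr s (Finset.mem_powerset.1 hT)]
  have hkey : ∀ ρ ∈ RepH ends p q H,
      ∑ T ∈ (compsH ends H ρ).powerset,
        (sigma ends (assignC ends T ρ) p q +
          sigma ends (assignC ends T (flipOH ends H ρ)) p q) *
          sigma ends (assignC ends T ρ) r s ≤ 0 := by
    intro ρ hρ
    set A := compsH ends H ρ with hA
    let Yc : Finset (Finset V) → ℤ := fun T => if Conn ends (assignC ends T ρ) p q then 1 else 0
    let Yc' : Finset (Finset V) → ℤ := fun T =>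
      if Conn ends (assignC ends T (flipOH ends H ρ)) p q then 1 else 0
    let G : Finset (Finset V) → ℤ := fun T => Yc T + Yc' T
    let D : Finset (Finset V) → ℤ := fun T => G T - G (A \ T)
    let S : Finset (Finset V) → ℤ := fun T => sigma ends (assignC ends T ρ) r s
    have hρO := flipOH_mem_RepH hρ
    have hmonoYc : ∀ T T', T ⊆ T' → T' ⊆ A → Yc T ≤ Yc T' := by
      intro T T' hTT hT'
      exact ite_le_ite_of_imp (conn_pq_assignC_mono_H hρ hTT hT')
    have hmonoYc' : ∀ T T', T ⊆ T' → T' ⊆ A → Yc' T ≤ Yc' T' := by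
      intro T T' hTT hT'
      have hT'O : T' ⊆ compsH ends H (flipOH ends H ρ) := by rw [compsH_flipOH]; exact hT'
      exact ite_le_ite_of_imp (conn_pq_assignC_mono_H hρO hTT hT'O)
    have hmonoD : ∀ T T', T ⊆ T' → T' ⊆ A → D T ≤ D T' := by
      intro T T' hTT hT'
      have h1 := hmonoYc T T' hTT hT'
      have h2 := hmonoYc' T T' hTT hT'
      have h3 := hmonoYc (A \ T') (A \ T) (Finset.sdiff_subset_sdiff (Finset.Subset.refl A) hTT)
        Finset.sdiff_subset
      have h4 := hmonoYc' (A \ T') (A \ T) (Finset.sdiff_subset_sdiff (Finset.Subset.refl A) hTT)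
        Finset.sdiff_subset
      simp only [D, G]
      linarith
    have hantiS : ∀ T T', T ⊆ T' → T' ⊆ A → S T' ≤ S T := by
      intro T T' hTT hT'
      show sigma ends (assignC ends T' ρ) r s ≤ sigma ends (assignC ends T ρ) r s
      unfold sigma
      exact sub_le_sub (ite_le_ite_of_imp (conn_rs_assignC_anti_H hρ hr s hTT hT'))
        (ite_le_ite_of_imp (conn_rs_compl_assignC_mono_H hρ hr s hTT hT'))
    have h0 : ∑ T ∈ A.powerset, D T = 0 := by
      simp only [D]
      rw [Finset.sum_sub_distrib, sum_powerset_sdiff, sub_self]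
    have hH := sum_mul_nonpos_of_monotone_antitone A D S hmonoD hantiS h0
    refine le_trans (le_of_eq ?_) hH
    refine Finset.sum_congr rfl (fun T hT => ?_)
    rw [sigma_pq_add_flipOH_C hρ (Finset.mem_powerset.1 hT)]
  have htwice : 2 * dzeroSignSumH ends p q r s H ≤ 0 := by
    calc 2 * dzeroSignSumH ends p q r s H
        = dzeroSignSumH ends p q r s H + dzeroSignSumH ends p q r s H := by ring
      _ = (∑ ρ ∈ RepH ends p q H, ∑ T ∈ (compsH ends H ρ).powerset,
            sigma ends (assignC ends T ρ) p q * sigma ends (assignC ends T ρ) r s) +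
          ∑ ρ ∈ RepH ends p q H, ∑ T ∈ (compsH ends H ρ).powerset,
            sigma ends (assignC ends T (flipOH ends H ρ)) p q *
              sigma ends (assignC ends T ρ) r s := by
          rw [← hsumO, ← hsum]
      _ = ∑ ρ ∈ RepH ends p q H, ∑ T ∈ (compsH ends H ρ).powerset,
            (sigma ends (assignC ends T ρ) p q +
              sigma ends (assignC ends T (flipOH ends H ρ)) p q) *
              sigma ends (assignC ends T ρ) r s := by
          rw [← Finset.sum_add_distrib]
          refine Finset.sum_congr rfl (fun ρ _ => ?_)
          rw [← Finset.sum_add_distrib]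
          refine Finset.sum_congr rfl (fun T _ => ?_)
          ring
      _ ≤ 0 := Finset.sum_nonpos (fun ρ hρ => hkey ρ hρ)
  linarith

/-- **The `S₃` piece of the single-`d` route**: for every graph and every vertex `d`,
`Σ_{ω ∈ Sep₃ ∩ DZero₃} σ_pq · σ_rs ≤ 0` with the terminal set `{r, s, d}`. -/
theorem dzeroSignSumH_nonpos_triple (p q r s d : V) :
    dzeroSignSumH ends p q r s ({r, s, d} : Set V) ≤ 0 :=
  dzeroSignSumH_nonpos p q s (Set.mem_insert r _)

/-- **The piece for every `D₀`**: for every graph and every set `D₀` of vertices,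
`Σ_{ω ∈ Sep_H ∩ DZero_H} σ_pq · σ_rs ≤ 0` with the terminal set `H = {r, s} ∪ D₀`. -/
theorem dzeroSignSumH_nonpos_union (p q r s : V) (D₀ : Set V) :
    dzeroSignSumH ends p q r s (({r, s} : Set V) ∪ D₀) ≤ 0 :=
  dzeroSignSumH_nonpos p q s (Set.mem_union_left _ (Set.mem_insert r _))

omit [Fintype V] [DecidableEq V] [Fintype E] [DecidableEq E] in
/-- A `sepH`-colouring for a terminal set containing `r, s` is a `Sep`-colouring. -/
lemma sep2_of_sepH {p q r s : V} {H : Set V} (hr : r ∈ H) (hs : s ∈ H) {ω : Config E}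
    (h : sepH ends p q H ω) : sep2 ends p q r s ω := by
  obtain ⟨hpK, hqK, hpM, hqM⟩ := h
  refine ⟨⟨?_, ?_, ?_, ?_⟩, ⟨?_, ?_, ?_, ?_⟩⟩
  · exact fun hc => hpK ⟨r, hr, conn_symm hc⟩
  · exact fun hc => hpK ⟨s, hs, conn_symm hc⟩
  · exact fun hc => hqK ⟨r, hr, conn_symm hc⟩
  · exact fun hc => hqK ⟨s, hs, conn_symm hc⟩
  · exact fun hc => hpM ⟨r, hr, conn_symm hc⟩
  · exact fun hc => hpM ⟨s, hs, conn_symm hc⟩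
  · exact fun hc => hqM ⟨r, hr, conn_symm hc⟩
  · exact fun hc => hqM ⟨s, hs, conn_symm hc⟩

omit [Fintype V] [DecidableEq V] [Fintype E] [DecidableEq E] in
/-- The `Y`-world of `{r, s}` lies in the `Y`-world of a terminal set containing `r, s`. -/
lemma K2_subset_KH {r s : V} {H : Set V} (hr : r ∈ H) (hs : s ∈ H) (ω : Config E) :
    K2 ends r s ω ⊆ KH ends H ω := by
  intro x hx
  rcases mem_K2_iff.1 hx with hc | hc
  · exact ⟨r, hr, hc⟩
  · exact ⟨s, hs, hc⟩

omit [Fintype V] [DecidableEq V] [Fintype E] [DecidableEq E] in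
/-- Under `DZeroH` for a terminal set containing `r, s`, no vertex outside `H` lies in both
worlds of `{r, s}`: the summation set of `dzeroSignSumH` is contained in `{D(ω) ⊆ H ∖ {r, s}}`. -/
lemma not_mem_both_of_DZeroH {r s : V} {H : Set V} (hr : r ∈ H) (hs : s ∈ H) {ω : Config E}
    (hD : DZeroH ends H ω) {x : V} (hxH : x ∉ H) (hK : x ∈ K2 ends r s ω) :
    x ∉ M2 ends r s ω := fun hM =>
  hD x hxH (K2_subset_KH hr hs ω hK) (K2_subset_KH hr hs (OneColourSwitch.compl ω) hM)

end Count

end TermSwitch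

end Summit.Ventures.PercRepro2
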